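import Mathlib.FieldTheory.PurelyInseparable.Exponent

/-!
# A finite purely inseparable extension `L ≠ K` has an intermediate field of index `p`

Stub `stub_pTower` of the line `degree-p-tower` of the crux `Picover`
(stmt-ResolutionOfSingularities-0554): pure field theory.

**Statement.** Let `p` be a prime, `K` a field of characteristic `p` and `L/K` a finite purely
inseparable extension with `[L : K] ≠ 1`. Then there is an intermediate field `M` of `L/K` with
`[L : M] = p`.

**Proof.** Strong induction on `n = [L : F]` over the intermediate fields `F` of `L/K`
(`exists_of_finrank_eq`). If `[L : F] ≠ 1` pick `x ∈ L ∖ F`; `L/F` is purely inseparable of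
characteristic `p`, so `x` has an exponent `e ≥ 1` over `F` (`x ^ p ^ e ∈ F`, `e` minimal) and
`a := x ^ p ^ (e - 1)` has exponent exactly `1`, whence `minpoly_F a = X ^ p - c` and
`[F(a) : F] = p` (`exists_finrank_adjoin_eq`, via Mathlib's `IsPurelyInseparable.elemExponent`
API). By the tower law `p · [L : F(a)] = n`; if `[L : F(a)] = 1` then `[L : F] = p` and `M := F`
answers, otherwise the induction hypothesis applies to `F(a)` (as an intermediate field of
`L/K`, `[L : F(a)] < n`). Finally apply this to `F = ⊥`.

Sources: folklore (e.g. N. Jacobson, *Basic Algebra II*, §8.7, purely inseparable extensions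
are towers of simple radical extensions of degree `p`); M. Temkin, *Inseparable local
uniformization*, J. Algebra 373 (2013), Rem. 1.3.5 (ii) for its use in the line.
-/

noncomputable section

set_option linter.dupNamespace false -- mandated namespace of this single-conjunct summit

open Polynomial IntermediateField

namespace Summit.ResolutionOfSingularities.ResolutionOfSingularities.Theorems.Picover.PTower

/-- **A radical element of degree exactly `p`.** In a purely inseparable extension `L/F` of
prime characteristic `p`, for every `x ∈ L ∖ F` some `a ∈ L` (namely `a = x ^ p ^ (e - 1)` for the
exponent `e` of `x` over `F`) generates a simple extension `F(a)` of degree `p` over `F`.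
[folklore] -/
theorem exists_finrank_adjoin_eq (p : ℕ) [Fact p.Prime] (F L : Type*) [Field F] [Field L]
    [Algebra F L] [CharP F p] [IsPurelyInseparable F L] {x : L}
    (hx : x ∉ (algebraMap F L).range) : ∃ a : L, Module.finrank F F⟮a⟯ = p := by
  have hp : p.Prime := Fact.out
  haveI : ExpChar F p := ExpChar.prime hp
  -- the exponent `e` of `x` is positive since `x ∉ F`
  have he0 : IsPurelyInseparable.elemExponent F x ≠ 0 := by
    intro h0
    apply hx
    have h := IsPurelyInseparable.algebraMap_elemReduct_eq' F p x
    rw [h0, pow_zero, pow_one] at h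
    exact ⟨_, h⟩
  refine ⟨x ^ p ^ (IsPurelyInseparable.elemExponent F x - 1), ?_⟩
  have hint : IsIntegral F (x ^ p ^ (IsPurelyInseparable.elemExponent F x - 1)) :=
    IsPurelyInseparable.isIntegral' F _
  -- `a ^ p = x ^ p ^ e ∈ F`, so the exponent of `a` is at most `1`
  have h1 : IsPurelyInseparable.elemExponent F
      (x ^ p ^ (IsPurelyInseparable.elemExponent F x - 1)) ≤ 1 := by
    refine IsPurelyInseparable.elemExponent_le_of_pow_mem' p ?_
    rw [pow_one, ← pow_mul, ← pow_succ,
      Nat.sub_add_cancel (Nat.one_le_iff_ne_zero.mpr he0)]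
    exact IsPurelyInseparable.elemExponent_def' F p x
  -- `a ∉ F` (minimality of `e`), so the exponent of `a` is positive
  have h2 : IsPurelyInseparable.elemExponent F
      (x ^ p ^ (IsPurelyInseparable.elemExponent F x - 1)) ≠ 0 := by
    intro h0
    refine IsPurelyInseparable.elemExponent_min' F p
      (Nat.sub_lt (Nat.pos_of_ne_zero he0) one_pos) ?_
    have h := IsPurelyInseparable.algebraMap_elemReduct_eq' F p
      (x ^ p ^ (IsPurelyInseparable.elemExponent F x - 1))
    rw [h0, pow_zero, pow_one] at h
    exact ⟨_, h⟩
  have hea : IsPurelyInseparable.elemExponent F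
      (x ^ p ^ (IsPurelyInseparable.elemExponent F x - 1)) = 1 := by omega
  rw [IntermediateField.adjoin.finrank hint, IsPurelyInseparable.minpoly_natDegree_eq' F p,
    hea, pow_one]

/-- **The induction on `[L : F]`.** For a finite purely inseparable extension `L/K` of prime
characteristic `p` and every intermediate field `F` with `[L : F] ≠ 1` there is an intermediate
field `M` of `L/K` with `[L : M] = p` (strong induction on `[L : F]`, adjoining to `F` a radical
element of degree `p` at each step). [folklore] -/
theorem exists_of_finrank_eq (p : ℕ) [Fact p.Prime] (K L : Type*) [Field K] [Field L]
    [Algebra K L] [CharP K p] [FiniteDimensional K L] [IsPurelyInseparable K L] :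
    ∀ (n : ℕ) (F : IntermediateField K L), Module.finrank F L = n → n ≠ 1 →
      ∃ M : IntermediateField K L, Module.finrank M L = p := by
  have hp : p.Prime := Fact.out
  intro n
  induction n using Nat.strong_induction_on with
  | _ n ih =>
    intro F hn h1
    have hFtop : F ≠ ⊤ := fun h =>
      h1 (hn ▸ IntermediateField.finrank_eq_one_iff_eq_top.mpr h)
    -- an element `x ∉ F`; `L/F` is purely inseparable of characteristic `p`
    obtain ⟨x, -, hxF⟩ := SetLike.exists_of_lt (lt_top_iff_ne_top.mpr hFtop)
    haveI : CharP F p := charP_of_injective_algebraMap (algebraMap K F).injective p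
    have hx : x ∉ (algebraMap F L).range := by
      rintro ⟨y, rfl⟩
      exact hxF y.2
    -- a radical element `a` of degree `p` over `F`
    obtain ⟨a, ha⟩ := exists_finrank_adjoin_eq p F L hx
    -- the tower law `p * [L : F(a)] = n`
    have hmul := Module.finrank_mul_finrank F F⟮a⟯ L
    rw [ha, hn] at hmul
    have hpos : 0 < Module.finrank F⟮a⟯ L := Module.finrank_pos
    by_cases hone : Module.finrank F⟮a⟯ L = 1
    · -- `L = F(a)`, so `[L : F] = p`
      refine ⟨F, ?_⟩
      rw [hn, ← hmul, hone, mul_one]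
    · -- induction hypothesis for `F' = F(a)` as an intermediate field of `L/K`
      have hlt : Module.finrank (F⟮a⟯.restrictScalars K) L < n := by
        change Module.finrank F⟮a⟯ L < n
        rw [← hmul]
        have h2 : 2 ≤ p := hp.two_le
        nlinarith
      exact ih _ hlt (F⟮a⟯.restrictScalars K) rfl hone

/-- **A finite purely inseparable extension `L ≠ K` of prime characteristic `p` has an
intermediate field of index `p`**: pick `x ∉ K`, `minpoly = X^{p^m} − a`, pass to
`K(x^{p^{m-1}})` (degree `p`) and induct on `[L : K]`. [folklore] -/
theorem stub_pTower : ∀ (p : ℕ) [Fact p.Prime] (K L : Type) [Field K] [Field L] [Algebra K L] [CharP K p] [FiniteDimensional K L] [IsPurelyInseparable K L], Module.finrank K L ≠ 1 → ∃ M : IntermediateField K L, Module.finrank M L = p := by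
  intro p _ K L _ _ _ _ _ _ hKL
  refine exists_of_finrank_eq p K L _ (⊥ : IntermediateField K L) rfl ?_
  rwa [IntermediateField.finrank_bot']

end Summit.ResolutionOfSingularities.ResolutionOfSingularities.Theorems.Picover.PTower

end
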